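import Mathlib
import Literature.MathematicalPhysics.QuantumFieldTheory.Balaban1983to89.Beta.VectorTails
import Literature.MathematicalPhysics.QuantumFieldTheory.Balaban1983to89.Beta.VectorPropagatorDict
import Literature.MathematicalPhysics.QuantumFieldTheory.Balaban1983to89.B5Blocks16
import Literature.MathematicalPhysics.QuantumFieldTheory.Balaban1983to89.Beta.PoissonInterior

/-!
# Beta / VectorTailsCov — the parametrix identity for the ENTRIES of Bałaban's covariant
# propagator `𝒢 = Δ_a⁻¹` at `U = 1` ((1.69)–(1.71) of [Balaban1984PropagatorsI]), realised on the
# tree's concrete operators (`B5DeltaA169.DeltaA`, `B5Prop11Plancherel.calG`)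

HONEST FRAMING (verbatim, page 1 of everything this cell writes): discharging `BetaPertH` makes
Bałaban's UV stability UNCONDITIONAL — a real constructive-QFT result; it is NOT the continuum
limit and NOT the Clay problem.  THIS MODULE discharges nothing of that and asserts nothing
printed: it is a Mathlib-elementary kernel certificate (ABSOLUTE RULE of the cell: zero cited
facts here, zero `sorry`; every `theorem` is kernel-checked and tagged [folklore]).

WHY (β sub-cell row an1, node BETA-an1-VECTOR-TAILS-PROP12, BETA-SPEC §7.24 (b), RULING (R13)):
the (W3a)₀ binders `hFtail` / `hGtail` of
`Beta.ComposedRoad.oneLoopDrift_of_composedLegInterfacePow` ask for mesh-uniform shell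
envelopes of the ENTRIES `𝒢((b+w, κ), (b, ν))` of `𝒢 = Δ_a⁻¹` and of their first / second
differences.  The printed input, Prop. 1.2 (1.110) of [Balaban1984PropagatorsI]
(tree leaf `B5.Prop12Printed`, quoted BY NAME downstream, never here), bounds `sup |(𝒢J)(x)|` by
`O(1) e^{-δ₀|y-y′|} sup |J|` for sources `J` spread over a unit cube: read on a POINT source it
loses the volume factor `η^{-d}` against the true size of an entry.  `Beta.VectorTails` supplies
the repair — Newton-potential parametrix + abstract localisation algebra; this module REALISES its
two algebraic inputs on the concrete operators of the tree:

* §1 (generic) `colOf f ν₀ (x, κ) = δ_{κν₀} f(x)` — the column of a scalar function; `lapTor`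
  the graph Laplacian of the fine torus; **`Lap_colOf`**: B5's vector Laplacian
  `Lap n M = Σ_ν ∇_ν^*∇_ν` ((1.21); `= ⊕_κ n²(−Δ₁)` by `VectorPropagatorDict.Lap_eq_blockDiagonal`)
  acts on a column as `−n² ×` the graph Laplacian of the scalar; **`Lap_colOf_of_pointwise`**:
  a scalar parametrix identity `Δ₁ f = −δ_{x₀} + ρ` lifts to
  `Lap (colOf f) = n² • (δ_{(x₀,ν₀)} − colOf ρ)`.
* §2 `Vop = Δ_a − Lap = −∂P∂* + aQ*Q` (`DeltaA_eq_Lap_add_Vop`, definitional regrouping of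
  `B5DeltaA169.DeltaA`) and **`calG_entry_eq_of_pointwise`**: for every entry,
  `𝒢 i (x₀,ν₀) = (𝒢 colOf ρ)(i) + n⁻² (colOf f (i) − (𝒢 (Vop (colOf f)))(i))` —
  `VectorTails.entry_eq_of_parametrix` fed with `B5DeltaA169.calG_mul_DeltaA`.
* §3 `sum_norm_QvOp_col` — the exact column sum `Σ_b |Q_k(b, i)| = η^d` of the averaging operator
  (1.18) (`B5Block118.QvOp`; from the block partition `B5Blocks16.bpt_bijective`), and the source
  size **`norm_QQ_mulVec_le`**: `|(Q*_kQ_k H)(i)| ≤ η^d Σ_{i′} |H(i′)|` (`Q*_k = η^{-d}Q_kᴴ`,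
  `B5DeltaA169.QvAdj`); `norm_aQQ_colOf_le`: the `aQ*Q`-part of the source of a column is
  `≤ a η^d Σ_x |f(x)|` pointwise.
* §4 (the Newton-potential specialisation) `colParam` / `colResid` — the columns of
  `VectorTails.paramT` / `residT`; **`Lap_colParam`** (from `VectorTails.lapT_paramT`, once
  `6m + 6 ≤ n M_μ`), **`calG_entry_eq`** (the identity above with `f = paramT`, `ρ = residT`), and
  `norm_aQQ_colParam_le`: with `VectorTails.sum_abs_paramT_le` (`Σ|h| ≤ C m²`) the `aQ*Q`-part of
  the source `Vop H` is `≤ a C m² η^d` pointwise, i.e. `O(η²)` at `m ≍ n`, `d = 4`.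
* §5 conversions for the shell profiles (beta-ref R-g31-1 (b), (c)): `pow_mul_exp_neg_le`
  (`t^k e^{−ct} ≤ (k/c)^k`), **`rate_loss`**
  (`η^{k+2} e^{−δ₁r/n} ≤ (k/(δ₁−δ′))^k η² r^{−k} e^{−δ′r/n}`: a remainder of size
  `η^{k+2}e^{−δ₁|v|/n}` fits under the scalar wall's profile `|v|^{−k}e^{−δ′|v|/n}` at the price of
  the rate), and **`sum_cube_exp_supNorm_le`** (`Σ_{‖z‖_∞ ≤ R} e^{−c‖z‖_∞} ≤ S(c, d)` uniformly in
  `R`).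
* §6 block geometry of the fine torus against the centred lift `VectorTails.liftZ`: the circular
  sup-distance `tdist y y′ = ‖liftZ (y′ − y)‖_∞` of a torus (minimality
  `supNorm_liftZ_le_of_castT_eq`, `tdist_triangle`, `tdist_comm`); **`sum_exp_tdist_le`** — the
  VOLUME-UNIFORM summability `Σ_{y′} e^{−c·tdist(y, y′)} ≤ S(c, d)` on every torus `Π_μ ℤ/N_μ`
  (R-g31-1 (c), the `hS` input of `VectorTails.norm_entry_le_of_parametrix`); the digit congruence
  `liftZ_bpt_sub_bpt` and **`supNorm_liftZ_sub_le`** — FINE DISTANCE VERSUS BLOCK DISTANCE,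
  `|v|_∞ ≤ n·tdist(blk x₀, blk x) + (n − 1)` and `n·tdist ≤ |v|_∞ + (n − 1)` for
  `v = liftZ (x − x₀)`, `blk = B5Blocks16.blockOf` (R-g31-1 (b): `e^{−δ₀·tdist} ≤
  e^{δ₀} e^{−(δ₀/n)|v|_∞}`, and a source supported in `|v|_∞ ≤ 3m` lives in blocks at distance
  `≤ 3m/n + 1`); `norm_restrictBlk_le_envelope` — packaging a bounded source of bounded block
  range into the exponential block envelopes `hρ` / `hVh` of the dictionary; and the SUPPORT OF
  `Q_k` IN BLOCK TERMS, `tdist_blockOf_le_one_of_QvOp_ne_zero` (a staple of (1.18) stays within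
  one block step: `bpt_add_tstep`).

CONVENTIONS (for the later dictionary to the printed leaves, recorded here, used nowhere in this
file): matrix entries of the tree's operators on `T_η` are `η^d ×` the paper's kernels, which are
densities for the `η^d`-weighted sum (precedent: `B5Block118.QsOp` has entries `η^d` where (1.20)
prints «(Q′_kλ)(y) = Σ_{x∈B^k(y)} η^d λ(x)»); `∂ = GradOp (fine n M) n` is the `η`-scaled forward
difference; `Q*_k = η^{-d}(Q_k)ᴴ` (`B5DeltaA169.QvAdj`).

NOT certified here (next files of the node): the block envelopes of the two sources `ρ`, `Vop H`
(the `∂P∂*` kernel leaf (1.126)–(1.127) = `B5.Kernel126_127Printed`, carried BY NAME as a binder,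
never discharged by citation), the
`B5.Setting` instance on which `B5.Prop12Printed` (quoted BY NAME) yields
`VectorTails.LocBound 𝒢 blk tdist C δ₀`, and the resulting per-base-point shell envelopes d0 / d1
(d2 only block-averaged, after a `C²` cutoff — see the cell journal).
-/

open Finset Matrix
open scoped BigOperators ComplexConjugate Matrix

namespace Literature.MathematicalPhysics.QuantumFieldTheory.Balaban1983to89.Beta.VectorTailsCov

open Literature.MathematicalPhysics.QuantumFieldTheory.King1986.Torus (lapF)
open Literature.MathematicalPhysics.QuantumFieldTheory.Balaban1983to89.B5Prop11Plancherel
open Literature.MathematicalPhysics.QuantumFieldTheory.Balaban1983to89.B5Prop11Lower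
open Literature.MathematicalPhysics.QuantumFieldTheory.Balaban1983to89.B5Action121
open Literature.MathematicalPhysics.QuantumFieldTheory.Balaban1983to89.B5Block118
open Literature.MathematicalPhysics.QuantumFieldTheory.Balaban1983to89.B5Value126
open Literature.MathematicalPhysics.QuantumFieldTheory.Balaban1983to89.B5DeltaA169
open Literature.MathematicalPhysics.QuantumFieldTheory.Balaban1983to89.Beta.VectorTails
open Literature.MathematicalPhysics.QuantumFieldTheory.Balaban1983to89.Beta.VectorPropagatorDict

noncomputable section

/-! ## §1 Columns of scalar functions and the vector Laplacian -/

section Column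

variable {d : ℕ} (n : ℕ) [NeZero n] (M : Fin d → ℕ) [hM : ∀ μ, NeZero (M μ)]

/-- the vector field with a single non-zero component: `colOf f ν₀ (x, κ) = δ_{κν₀} · f(x)`.
[folklore] -/
def colOf (f : Tor (fine n M) → ℝ) (ν₀ : Fin d) : Tor (fine n M) × Fin d → ℂ :=
  fun i => if i.2 = ν₀ then ((f i.1 : ℝ) : ℂ) else 0

omit [NeZero n] hM in
/-- Elementary helper of §1 (`colOf_apply`); the statement is its own description. [folklore] -/
theorem colOf_apply (f : Tor (fine n M) → ℝ) (ν₀ : Fin d) (i : Tor (fine n M) × Fin d) :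
    colOf n M f ν₀ i = if i.2 = ν₀ then ((f i.1 : ℝ) : ℂ) else 0 := rfl

/-- the `ℓ¹` size of a column is that of the scalar function. [folklore] -/
theorem sum_norm_colOf (f : Tor (fine n M) → ℝ) (ν₀ : Fin d) :
    ∑ i, ‖colOf n M f ν₀ i‖ = ∑ x, |f x| := by
  rw [Fintype.sum_prod_type_right]
  rw [Finset.sum_eq_single ν₀ (fun κ _ hκ => by simp [colOf, hκ]) (by simp)]
  simp [colOf, Complex.norm_real]

/-- the graph Laplacian of the fine torus, `Σ_i (f(x+e_i) + f(x−e_i)) − 2d f(x)` (the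
normalisation of `VectorTails.lapT` and of `latticeLaplacianZd`). [folklore] -/
def lapTor (f : Tor (fine n M) → ℝ) (x : Tor (fine n M)) : ℝ :=
  ∑ i : Fin d, (f (x + Pi.single i 1) + f (x - Pi.single i 1)) - 2 * d * f x

/-- **The vector Laplacian of a column**: B5's `Lap n M = Σ_ν ∇_ν^*∇_ν` ((1.21);
`= ⊕_κ n²(−Δ₁)` by `VectorPropagatorDict.Lap_eq_blockDiagonal`) acts on `colOf f ν₀` as
`−n²` times the graph Laplacian, componentwise. [folklore] -/
theorem Lap_colOf (f : Tor (fine n M) → ℝ) (ν₀ : Fin d) :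
    Lap n M *ᵥ colOf n M f ν₀ = colOf n M (fun x => -((n : ℝ) ^ 2) * lapTor n M f x) ν₀ := by
  haveI : ∀ μ, NeZero (fine n M μ) := fun μ => inferInstance
  funext ⟨x, κ⟩
  rw [Lap_eq_blockDiagonal, blockDiagonal_mulVec_apply, lapF_map_mulVec]
  simp only [B5Action121.comp, colOf]
  by_cases hκ : κ = ν₀
  · simp only [hκ, if_true]
    have hu : ∀ i : Fin d, unitVec (fine n M) i = Pi.single i 1 := fun i => rfl
    simp only [hu, lapTor]
    push_cast
    ring
  · simp only [hκ, if_false]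
    simp

/-- **The parametrix-column equation**: if `f` solves `Δ₁ f = −δ_{x₀} + ρ` pointwise on the fine
torus (as `VectorTails.lapT_paramT` provides for the Newton parametrix), then
`Lap (colOf f ν₀) = n² • (δ_{(x₀,ν₀)} − colOf ρ ν₀)`. [folklore] -/
theorem Lap_colOf_of_pointwise {f ρ : Tor (fine n M) → ℝ} {x₀ : Tor (fine n M)}
    (hf : ∀ x, lapTor n M f x = -(if x = x₀ then 1 else 0) + ρ x) (ν₀ : Fin d) :
    Lap n M *ᵥ colOf n M f ν₀
      = ((n : ℂ) ^ 2) • (Pi.single (x₀, ν₀) 1 - colOf n M ρ ν₀) := by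
  rw [Lap_colOf]
  funext ⟨x, κ⟩
  simp only [colOf, Pi.smul_apply, Pi.sub_apply, smul_eq_mul]
  by_cases hκ : κ = ν₀
  · simp only [hκ, if_true]
    have hδ : (Pi.single (x₀, ν₀) (1 : ℂ) : Tor (fine n M) × Fin d → ℂ) (x, ν₀)
        = if x = x₀ then 1 else 0 := by
      by_cases hx : x = x₀
      · rw [if_pos hx, hx]; exact Pi.single_eq_same _ _
      · rw [if_neg hx, Pi.single_eq_of_ne (fun h => hx (congrArg Prod.fst h))]
    rw [hδ, hf x]
    push_cast
    split_ifs <;> push_cast <;> ring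
  · simp only [hκ, if_false]
    have hδ : (Pi.single (x₀, ν₀) (1 : ℂ) : Tor (fine n M) × Fin d → ℂ) (x, κ) = 0 :=
      Pi.single_eq_of_ne (fun h => hκ (congrArg Prod.snd h)) _
    rw [hδ]
    simp

end Column

/-! ## §2 `Δ_a = Lap + V` and the parametrix identity for the entries of `𝒢` -/

section Entry

variable {d : ℕ} (n : ℕ) [NeZero n] (M : Fin d → ℕ) [hM : ∀ μ, NeZero (M μ)] (a : ℝ)

/-- `V := Δ_a − Δ = −∂P∂* + aQ*Q` (the zeroth/first-order, unit-scale-nonlocal part of (1.69)).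
[folklore] -/
def Vop : Matrix (Tor (fine n M) × Fin d) (Tor (fine n M) × Fin d) ℂ :=
  -(GradOp (fine n M) (n : ℂ) * PcT n M (n : ℂ) * (GradOp (fine n M) (n : ℂ))ᴴ)
    + (a : ℂ) • (QvAdj n M * QvOp n M)

/-- `Δ_a = Δ + V`. [folklore] -/
theorem DeltaA_eq_Lap_add_Vop : DeltaA n M a = Lap n M + Vop n M a := by
  rw [DeltaA, Vop, sub_eq_add_neg, add_assoc]

variable (hn : 1 ≤ n) (ha : 0 < a)

/-- **THE PARAMETRIX IDENTITY FOR THE ENTRIES OF `𝒢 = Δ_a⁻¹`** (generic scalar parametrix):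
if `Δ₁ f = −δ_{x₀} + ρ` pointwise, then for every entry
`𝒢(i, (x₀,ν₀)) = (𝒢 colOf ρ)(i) + n⁻² (colOf f (i) − (𝒢 (V colOf f))(i))`
(`VectorTails.entry_eq_of_parametrix` with `B5DeltaA169.calG_mul_DeltaA`). [folklore] -/
theorem calG_entry_eq_of_pointwise {f ρ : Tor (fine n M) → ℝ} {x₀ : Tor (fine n M)}
    (hf : ∀ x, lapTor n M f x = -(if x = x₀ then 1 else 0) + ρ x) (ν₀ : Fin d)
    (i : Tor (fine n M) × Fin d) :
    calG n hn M a ha i (x₀, ν₀)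
      = (calG n hn M a ha *ᵥ colOf n M ρ ν₀) i
        + ((n : ℂ) ^ 2)⁻¹ * (colOf n M f ν₀ i
            - (calG n hn M a ha *ᵥ (Vop n M a *ᵥ colOf n M f ν₀)) i) :=
  entry_eq_of_parametrix (calG_mul_DeltaA n hn M a ha) (DeltaA_eq_Lap_add_Vop n M a)
    (Lap_colOf_of_pointwise n M hf ν₀) (pow_ne_zero 2 (Nat.cast_ne_zero.mpr (NeZero.ne n))) i

end Entry

/-! ## §3 The column sums of the averaging operator `Q_k` and the size of `Q*_kQ_k H` -/

section Averaging

variable {d : ℕ} (n : ℕ) [NeZero n] (M : Fin d → ℕ) [hM : ∀ μ, NeZero (M μ)]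

omit [NeZero n] hM in
/-- the entries of `Q_k` ((1.18), `B5Block118.QvOp`) at `b = (y, μ)`, `i = (x, κ)`:
`δ_{κμ} · η^{d+1} · #{(j, t) : x = n·y + j + t e_μ}`. [folklore] -/
theorem QvOp_apply_eq (y : Tor M) (μ : Fin d) (x : Tor (fine n M)) (κ : Fin d) :
    QvOp n M (y, μ) (x, κ) = if κ = μ then
      (∑ j : Fin d → Fin n, ∑ t : Fin n,
          (if x = bpt n M y j + tstep (fine n M) μ (t : ℕ) then (1 : ℂ) else 0)) / (n : ℂ) ^ (d + 1)
      else 0 := by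
  simp only [QvOp]
  split_ifs with h
  · rw [Finset.sum_div]
    refine Finset.sum_congr rfl fun j _ => ?_
    rw [Finset.sum_div]
    refine Finset.sum_congr rfl fun t _ => ?_
    split_ifs <;> simp
  · rfl

omit [NeZero n] hM in
/-- `‖Q_k((y, μ), (x, κ))‖ = δ_{κμ} · #{(j, t) : x = n·y + j + t e_μ} / n^{d+1}`. [folklore] -/
theorem norm_QvOp_apply (y : Tor M) (μ : Fin d) (x : Tor (fine n M)) (κ : Fin d) :
    ‖QvOp n M (y, μ) (x, κ)‖ = if κ = μ then
      (∑ j : Fin d → Fin n, ∑ t : Fin n,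
          (if x = bpt n M y j + tstep (fine n M) μ (t : ℕ) then (1 : ℝ) else 0)) / (n : ℝ) ^ (d + 1)
      else 0 := by
  rw [QvOp_apply_eq]
  split_ifs
  · have hre : (∑ j : Fin d → Fin n, ∑ t : Fin n,
          (if x = bpt n M y j + tstep (fine n M) μ (t : ℕ) then (1 : ℂ) else 0))
        = ((∑ j : Fin d → Fin n, ∑ t : Fin n,
          (if x = bpt n M y j + tstep (fine n M) μ (t : ℕ) then (1 : ℝ) else 0) : ℝ) : ℂ) := by
      push_cast
      refine Finset.sum_congr rfl fun j _ => Finset.sum_congr rfl fun t _ => ?_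
      split_ifs <;> simp
    have hnn : 0 ≤ ∑ j : Fin d → Fin n, ∑ t : Fin n,
        (if x = bpt n M y j + tstep (fine n M) μ (t : ℕ) then (1 : ℝ) else 0) :=
      Finset.sum_nonneg fun j _ => Finset.sum_nonneg fun t _ => by split_ifs <;> norm_num
    rw [hre, norm_div, norm_pow, Complex.norm_natCast, Complex.norm_real, Real.norm_eq_abs,
      abs_of_nonneg hnn]
  · exact norm_zero

/-- **The column sums of `Q_k` are exactly `η^d`**: every fine bond `i = (x, κ)` lies on exactly
`n` of the straight contours averaged in (1.18) (one for each `t`, by the block partition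
`B5Blocks16.bpt_bijective`), each weighted `η^{d+1}`. [folklore] -/
theorem sum_norm_QvOp_col (i : Tor (fine n M) × Fin d) :
    ∑ b, ‖QvOp n M b i‖ = 1 / (n : ℝ) ^ d := by
  obtain ⟨x, κ⟩ := i
  have hn : (n : ℝ) ≠ 0 := Nat.cast_ne_zero.mpr (NeZero.ne n)
  rw [Fintype.sum_prod_type]
  have h1 : ∀ y : Tor M, ∑ μ : Fin d, ‖QvOp n M (y, μ) (x, κ)‖
      = (∑ j : Fin d → Fin n, ∑ t : Fin n,
          (if x = bpt n M y j + tstep (fine n M) κ (t : ℕ) then (1 : ℝ) else 0)) /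
            (n : ℝ) ^ (d + 1) := by
    intro y
    rw [Finset.sum_eq_single κ
      (fun μ _ hμ => by rw [norm_QvOp_apply, if_neg (Ne.symm hμ)]) (by simp),
      norm_QvOp_apply, if_pos rfl]
  simp_rw [h1]
  have h2 : ∀ t : Fin n, ∑ y : Tor M, ∑ j : Fin d → Fin n,
      (if x = bpt n M y j + tstep (fine n M) κ (t : ℕ) then (1 : ℝ) else 0) = 1 := by
    intro t
    rw [← Fintype.sum_prod_type (f := fun yj : Tor M × (Fin d → Fin n) =>
      if x = bpt n M yj.1 yj.2 + tstep (fine n M) κ (t : ℕ) then (1 : ℝ) else 0)]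
    rw [(B5Blocks16.bpt_bijective n M).sum_comp
      (fun z : Tor (fine n M) => if x = z + tstep (fine n M) κ (t : ℕ) then (1 : ℝ) else 0)]
    have e : ∀ z : Tor (fine n M),
        (if x = z + tstep (fine n M) κ (t : ℕ) then (1 : ℝ) else 0)
          = if x - tstep (fine n M) κ (t : ℕ) = z then 1 else 0 := by
      intro z
      by_cases hz : x = z + tstep (fine n M) κ (t : ℕ)
      · rw [if_pos hz, if_pos (by rw [hz, add_sub_cancel_right])]
      · rw [if_neg hz, if_neg (fun h => hz (by rw [← h, sub_add_cancel]))]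
    simp_rw [e]
    rw [Finset.sum_ite_eq, if_pos (Finset.mem_univ _)]
  have h3 : ∑ y : Tor M, ∑ j : Fin d → Fin n, ∑ t : Fin n,
      (if x = bpt n M y j + tstep (fine n M) κ (t : ℕ) then (1 : ℝ) else 0) = n := by
    have step : ∀ y : Tor M, ∑ j : Fin d → Fin n, ∑ t : Fin n,
        (if x = bpt n M y j + tstep (fine n M) κ (t : ℕ) then (1 : ℝ) else 0)
        = ∑ t : Fin n, ∑ j : Fin d → Fin n,
        (if x = bpt n M y j + tstep (fine n M) κ (t : ℕ) then (1 : ℝ) else 0) :=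
      fun y => Finset.sum_comm
    simp_rw [step]
    rw [Finset.sum_comm]
    simp_rw [h2]
    simp
  rw [← Finset.sum_div, h3, pow_succ]
  field_simp

/-- each entry of `Q_k` is at most the column sum `η^d`. [folklore] -/
theorem norm_QvOp_le (b : Tor M × Fin d) (i : Tor (fine n M) × Fin d) :
    ‖QvOp n M b i‖ ≤ 1 / (n : ℝ) ^ d := by
  rw [← sum_norm_QvOp_col n M i]
  exact Finset.single_le_sum (f := fun b => ‖QvOp n M b i‖) (fun _ _ => norm_nonneg _)
    (Finset.mem_univ b)

/-- **The size of the block-averaging part of the source**: `‖(Q*_kQ_k H)(i)‖ ≤ η^d Σ_{i′} ‖H(i′)‖`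
(`Q*_k = η^{-d}Q_kᴴ`). [folklore] -/
theorem norm_QQ_mulVec_le (H : Tor (fine n M) × Fin d → ℂ) (i : Tor (fine n M) × Fin d) :
    ‖((QvAdj n M * QvOp n M) *ᵥ H) i‖ ≤ 1 / (n : ℝ) ^ d * ∑ i', ‖H i'‖ := by
  have hn : (n : ℝ) ≠ 0 := Nat.cast_ne_zero.mpr (NeZero.ne n)
  have hentry : ∀ i', (QvAdj n M * QvOp n M) i i'
      = (n : ℂ) ^ d * ∑ b, star (QvOp n M b i) * QvOp n M b i' := by
    intro i'
    simp only [QvAdj, Matrix.smul_apply, Matrix.mul_apply, Matrix.conjTranspose_apply,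
      smul_eq_mul]
    rw [Finset.mul_sum]
    exact Finset.sum_congr rfl fun b _ => by ring
  have hcoef : ∀ i', ‖(QvAdj n M * QvOp n M) i i'‖ ≤ 1 / (n : ℝ) ^ d := by
    intro i'
    rw [hentry, norm_mul, norm_pow, Complex.norm_natCast]
    calc (n : ℝ) ^ d * ‖∑ b, star (QvOp n M b i) * QvOp n M b i'‖
        ≤ (n : ℝ) ^ d * ∑ b, ‖QvOp n M b i‖ * ‖QvOp n M b i'‖ := by
          gcongr
          exact (norm_sum_le _ _).trans
            (le_of_eq (Finset.sum_congr rfl fun b _ => by rw [norm_mul, norm_star]))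
      _ ≤ (n : ℝ) ^ d * ∑ b, ‖QvOp n M b i‖ * (1 / (n : ℝ) ^ d) := by
          gcongr with b _
          exact norm_QvOp_le n M b i'
      _ = 1 / (n : ℝ) ^ d := by
          rw [← Finset.sum_mul, sum_norm_QvOp_col]
          field_simp
  calc ‖((QvAdj n M * QvOp n M) *ᵥ H) i‖
      = ‖∑ i', (QvAdj n M * QvOp n M) i i' * H i'‖ := rfl
    _ ≤ ∑ i', ‖(QvAdj n M * QvOp n M) i i' * H i'‖ := norm_sum_le _ _
    _ ≤ ∑ i', 1 / (n : ℝ) ^ d * ‖H i'‖ := Finset.sum_le_sum fun i' _ => by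
          rw [norm_mul]
          exact mul_le_mul_of_nonneg_right (hcoef i') (norm_nonneg _)
    _ = 1 / (n : ℝ) ^ d * ∑ i', ‖H i'‖ := by rw [Finset.mul_sum]

/-- **The block-averaging part of the source of a column is `O(a ‖f‖₁ η^d)` pointwise**:
`‖(aQ*_kQ_k colOf f ν₀)(i)‖ ≤ a η^d Σ_x |f(x)|`; with `VectorTails.sum_abs_paramT_le`
(`Σ|h| ≤ C m²`) this is `O(a m² η^d)` for the parametrix column. [folklore] -/
theorem norm_aQQ_colOf_le {a : ℝ} (ha : 0 ≤ a) (f : Tor (fine n M) → ℝ) (ν₀ : Fin d)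
    (i : Tor (fine n M) × Fin d) :
    ‖(((a : ℂ) • (QvAdj n M * QvOp n M)) *ᵥ colOf n M f ν₀) i‖
      ≤ a * (1 / (n : ℝ) ^ d) * ∑ x, |f x| := by
  rw [Matrix.smul_mulVec, Pi.smul_apply, norm_smul, Complex.norm_real, Real.norm_eq_abs,
    abs_of_nonneg ha, mul_assoc]
  refine mul_le_mul_of_nonneg_left ?_ ha
  rw [← sum_norm_colOf n M f ν₀]
  exact norm_QQ_mulVec_le n M _ i

end Averaging

/-! ## §4 Specialisation to the Newton parametrix of `Beta.VectorTails` -/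

section Newton

variable {d : ℕ} (n : ℕ) [NeZero n] (M : Fin d → ℕ) [hM : ∀ μ, NeZero (M μ)] (a : ℝ)

omit [NeZero n] hM in
/-- `lapTor` is `VectorTails.lapT` on the fine torus. [folklore] -/
theorem lapTor_eq_lapT (f : Tor (fine n M) → ℝ) (x : Tor (fine n M)) :
    lapTor n M f x = lapT f x := rfl

/-- the parametrix column for the bond `(x₀, ν₀)`: `H(x, κ) = δ_{κν₀} · h_{x₀}(x)`,
`h_{x₀} = VectorTails.paramT m x₀`. [folklore] -/
def colParam (m : ℕ) (x₀ : Tor (fine n M)) (ν₀ : Fin d) : Tor (fine n M) × Fin d → ℂ :=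
  colOf n M (paramT m x₀) ν₀

/-- the residual column for the bond `(x₀, ν₀)`: `ρ(x, κ) = δ_{κν₀} · ρ_{x₀}(x)`,
`ρ_{x₀} = VectorTails.residT m x₀`. [folklore] -/
def colResid (m : ℕ) (x₀ : Tor (fine n M)) (ν₀ : Fin d) : Tor (fine n M) × Fin d → ℂ :=
  colOf n M (residT m x₀) ν₀

/-- **`Lap H = n² • (δ_{(x₀,ν₀)} − ρ)`** for the parametrix column, once the `3m`-cube and its
neighbours fit inside one period (`VectorTails.lapT_paramT`). [folklore] -/
theorem Lap_colParam (hd : 3 ≤ d) {m : ℕ} (hm : 1 ≤ m) (hNm : ∀ μ, 6 * m + 6 ≤ fine n M μ)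
    (x₀ : Tor (fine n M)) (ν₀ : Fin d) :
    Lap n M *ᵥ colParam n M m x₀ ν₀
      = ((n : ℂ) ^ 2) • (Pi.single (x₀, ν₀) 1 - colResid n M m x₀ ν₀) :=
  Lap_colOf_of_pointwise n M (fun x => lapT_paramT hd hm hNm x₀ x) ν₀

variable (hn : 1 ≤ n) (ha : 0 < a)

/-- **THE PARAMETRIX IDENTITY FOR THE ENTRIES OF BAŁABAN'S `𝒢 = Δ_a⁻¹` AT `U = 1`**:
`𝒢(i, (x₀,ν₀)) = (𝒢ρ)(i) + n⁻² (H(i) − (𝒢(VH))(i))`, `H = colParam m x₀ ν₀`,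
`ρ = colResid m x₀ ν₀`, `V = −∂P∂* + aQ*Q`, for `d ≥ 3`, `m ≥ 1`, `6m + 6 ≤ nM_μ`. [folklore] -/
theorem calG_entry_eq (hd : 3 ≤ d) {m : ℕ} (hm : 1 ≤ m) (hNm : ∀ μ, 6 * m + 6 ≤ fine n M μ)
    (x₀ : Tor (fine n M)) (ν₀ : Fin d) (i : Tor (fine n M) × Fin d) :
    calG n hn M a ha i (x₀, ν₀)
      = (calG n hn M a ha *ᵥ colResid n M m x₀ ν₀) i
        + ((n : ℂ) ^ 2)⁻¹ * (colParam n M m x₀ ν₀ i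
            - (calG n hn M a ha *ᵥ (Vop n M a *ᵥ colParam n M m x₀ ν₀)) i) :=
  calG_entry_eq_of_pointwise n M a hn ha (fun x => lapT_paramT hd hm hNm x₀ x) ν₀ i

omit hM in
/-- **The block-averaging part of the source of the parametrix column is `O(a m² η^d)`
pointwise**, with the constant `C(d)` of `VectorTails.sum_abs_paramT_le` quantified before the
volume, the bond and `m`. [folklore] -/
theorem norm_aQQ_colParam_le (hd : 3 ≤ d) (ha' : 0 ≤ a) :
    ∃ C : ℝ, 0 ≤ C ∧ ∀ (M' : Fin d → ℕ) [∀ μ, NeZero (M' μ)], ∀ m : ℕ, 1 ≤ m →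
      ∀ (x₀ : Tor (fine n M')) (ν₀ : Fin d) (i : Tor (fine n M') × Fin d),
        ‖(((a : ℂ) • (QvAdj n M' * QvOp n M')) *ᵥ colParam n M' m x₀ ν₀) i‖
          ≤ a * (C * (m : ℝ) ^ 2) / (n : ℝ) ^ d := by
  obtain ⟨C, hC, hsum⟩ := sum_abs_paramT_le (d := d) hd
  refine ⟨C, hC, fun M' _ m hm x₀ ν₀ i => ?_⟩
  refine (norm_aQQ_colOf_le n M' ha' (paramT m x₀) ν₀ i).trans ?_
  rw [mul_assoc, mul_div_assoc]
  refine mul_le_mul_of_nonneg_left ?_ ha'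
  rw [div_eq_mul_one_div (C * (m : ℝ) ^ 2), mul_comm (C * (m : ℝ) ^ 2)]
  exact mul_le_mul_of_nonneg_left (hsum (fine n M') m hm x₀) (by positivity)

end Newton

/-! ## §5 Conversions for the shell profiles (beta-ref R-g31-1 (b), (c)): rate loss and cube sums -/

section Conversions

open Literature.MathematicalPhysics.QuantumFieldTheory.Balaban1983to89.Beta.PoissonInterior

/-- `t e^{−ct} ≤ c⁻¹` for `c > 0` (from `x + 1 ≤ eˣ`). [folklore] -/
theorem mul_exp_neg_le' {c : ℝ} (hc : 0 < c) (t : ℝ) :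
    t * Real.exp (-(c * t)) ≤ c⁻¹ := by
  have h1 : c * t ≤ Real.exp (c * t) := by linarith [Real.add_one_le_exp (c * t)]
  have hE : Real.exp (c * t) * Real.exp (-(c * t)) = 1 := by
    rw [← Real.exp_add, add_neg_cancel, Real.exp_zero]
  have h2 : c * (t * Real.exp (-(c * t))) ≤ 1 :=
    calc c * (t * Real.exp (-(c * t))) = (c * t) * Real.exp (-(c * t)) := by ring
      _ ≤ Real.exp (c * t) * Real.exp (-(c * t)) :=
          mul_le_mul_of_nonneg_right h1 (Real.exp_pos _).le
      _ = 1 := hE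
  rw [inv_eq_one_div, le_div_iff₀ hc]
  linarith

/-- `t^k e^{−ct} ≤ (k/c)^k` for `t ≥ 0`, `c > 0`, `k ≥ 1`. [folklore] -/
theorem pow_mul_exp_neg_le {k : ℕ} (hk : 1 ≤ k) {c : ℝ} (hc : 0 < c) {t : ℝ} (ht : 0 ≤ t) :
    t ^ k * Real.exp (-(c * t)) ≤ ((k : ℝ) / c) ^ k := by
  have hk0 : (0 : ℝ) < k := by exact_mod_cast hk
  have h1 := mul_exp_neg_le' (c := c / k) (by positivity) t
  rw [inv_div] at h1
  have h2 : (t * Real.exp (-(c / k * t))) ^ k ≤ ((k : ℝ) / c) ^ k :=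
    pow_le_pow_left₀ (by positivity) h1 k
  have e : t ^ k * Real.exp (-(c * t)) = (t * Real.exp (-(c / k * t))) ^ k := by
    rw [mul_pow, ← Real.exp_nat_mul]
    congr 2
    field_simp
  rw [e]
  exact h2

/-- **RATE LOSS** (R-g31-1 (b)): `n^{−(k+2)} e^{−δ₁r/n} ≤ (k/(δ₁−δ′))^k · n^{−2} r^{−k} e^{−δ′r/n}`
for `0 < δ′ < δ₁` — how a remainder of size `η^{k+2}e^{−δ₁|v|/n}` fits under the shell profile
`|v|^{−k} e^{−δ′|v|/n}` of the scalar wall, at the price of the rate. [folklore] -/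
theorem rate_loss {k : ℕ} (hk : 1 ≤ k) {δ₁ δ' : ℝ} (hδ : δ' < δ₁) {n r : ℝ} (hn : 0 < n)
    (hr : 0 < r) :
    (1 / n) ^ (k + 2) * Real.exp (-(δ₁ * r / n))
      ≤ ((k : ℝ) / (δ₁ - δ')) ^ k * ((1 / n) ^ 2 * (1 / r) ^ k * Real.exp (-(δ' * r / n))) := by
  have key := pow_mul_exp_neg_le hk (c := δ₁ - δ') (by linarith) (t := r / n) (by positivity)
  have e1 : (1 / n) ^ (k + 2) * Real.exp (-(δ₁ * r / n))
      = ((r / n) ^ k * Real.exp (-((δ₁ - δ') * (r / n))))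
          * ((1 / n) ^ 2 * (1 / r) ^ k * Real.exp (-(δ' * r / n))) := by
    rw [show -(δ₁ * r / n) = -((δ₁ - δ') * (r / n)) + -(δ' * r / n) by ring, Real.exp_add]
    have hn' := hn.ne'
    have hr' := hr.ne'
    have e2 : (r / n) * (1 / r) = 1 / n := by field_simp
    have : (1 / n) ^ (k + 2) = (r / n) ^ k * ((1 / n) ^ 2 * (1 / r) ^ k) := by
      calc (1 / n) ^ (k + 2) = ((r / n) * (1 / r)) ^ k * (1 / n) ^ 2 := by rw [e2, pow_add]
        _ = _ := by rw [mul_pow]; ring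
    rw [this]; ring
  rw [e1]
  exact mul_le_mul_of_nonneg_right key (by positivity)

/-- **CUBE SUMS OF THE EXPONENTIAL PROFILE ARE BOUNDED UNIFORMLY IN THE CUBE** (R-g31-1 (c), the
`ℤ^d` half of the volume-uniform summability `hS`):
`Σ_{‖z‖_∞ ≤ R} e^{−c‖z‖_∞} ≤ 1 + 2d·3^{d−1}·(2(d−1)/c)^{d−1}·(1 − e^{−c/2})⁻¹`, `d ≥ 2`, every `R`
(shell counting `PoissonInterior.card_shell_le`). [folklore] -/
theorem sum_cube_exp_supNorm_le {d : ℕ} (hd : 2 ≤ d) {c : ℝ} (hc : 0 < c) (R : ℕ) :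
    ∑ z ∈ cube (0 : Fin d → ℤ) R, Real.exp (-(c * supNorm z))
      ≤ 1 + 2 * d * 3 ^ (d - 1) * ((((d - 1 : ℕ) : ℝ)) / (c / 2)) ^ (d - 1)
          * (1 - Real.exp (-(c / 2)))⁻¹ := by
  have hd0 : 0 < d := by omega
  set x : ℝ := Real.exp (-(c / 2)) with hx
  have hx0 : 0 ≤ x := (Real.exp_pos _).le
  have hx1 : x < 1 := by rw [hx]; exact Real.exp_lt_one_iff.mpr (by linarith)
  set K : ℝ := ((((d - 1 : ℕ) : ℝ)) / (c / 2)) ^ (d - 1) with hK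
  have hK0 : 0 ≤ K := by positivity
  have hmaps : ∀ z ∈ cube (0 : Fin d → ℤ) R, supNorm z ∈ Finset.range (R + 1) := by
    intro z hz
    rw [Finset.mem_range]
    exact Nat.lt_succ_of_le (mem_cube_zero_iff.1 hz)
  rw [← Finset.sum_fiberwise_of_maps_to hmaps]
  have hfib : ∀ j ∈ Finset.range (R + 1),
      ∑ z ∈ (cube (0 : Fin d → ℤ) R).filter (fun z => supNorm z = j), Real.exp (-(c * supNorm z))
        = (((cube (0 : Fin d → ℤ) R).filter (fun z => supNorm z = j)).card : ℝ)
            * Real.exp (-(c * j)) := by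
    intro j _
    rw [Finset.sum_congr rfl (fun z hz => by rw [(Finset.mem_filter.1 hz).2]), Finset.sum_const,
      nsmul_eq_mul]
  rw [Finset.sum_congr rfl hfib, Finset.sum_range_succ', shell_zero, Finset.card_singleton,
    Nat.cast_zero, mul_zero, neg_zero, Real.exp_zero, Nat.cast_one, one_mul]
  -- each shell term
  have hterm : ∀ j : ℕ, (((cube (0 : Fin d → ℤ) R).filter (fun z => supNorm z = (j + 1))).card : ℝ)
      * Real.exp (-(c * ((j + 1 : ℕ) : ℝ))) ≤ 2 * d * 3 ^ (d - 1) * K * x ^ j := by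
    intro j
    have hc1 := card_shell_le hd0 R (j + 1) (by omega)
    have ht : (0 : ℝ) ≤ ((j + 1 : ℕ) : ℝ) := by positivity
    have hp := pow_mul_exp_neg_le (k := d - 1) (by omega) (c := c / 2) (by positivity) ht
    -- (2(j+1)+1)^{d-1} ≤ (3(j+1))^{d-1}
    have h3 : ((2 : ℝ) * ((j + 1 : ℕ) : ℝ) + 1) ^ (d - 1) ≤ (3 * ((j + 1 : ℕ) : ℝ)) ^ (d - 1) := by
      apply pow_le_pow_left₀ (by positivity)
      have : (1 : ℝ) ≤ ((j + 1 : ℕ) : ℝ) := by exact_mod_cast Nat.succ_le_succ (Nat.zero_le j)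
      linarith
    have hsplit : Real.exp (-(c * ((j + 1 : ℕ) : ℝ)))
        = Real.exp (-(c / 2 * ((j + 1 : ℕ) : ℝ))) * (x ^ j * x) := by
      rw [hx, ← Real.exp_nat_mul, ← Real.exp_add, ← Real.exp_add]
      congr 1
      push_cast
      ring
    calc (((cube (0 : Fin d → ℤ) R).filter (fun z => supNorm z = (j + 1))).card : ℝ)
          * Real.exp (-(c * ((j + 1 : ℕ) : ℝ)))
        ≤ (2 * d * (2 * ((j + 1 : ℕ) : ℝ) + 1) ^ (d - 1))
            * Real.exp (-(c * ((j + 1 : ℕ) : ℝ))) := by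
          refine mul_le_mul_of_nonneg_right ?_ (Real.exp_pos _).le
          exact_mod_cast hc1
      _ ≤ (2 * d * (3 * ((j + 1 : ℕ) : ℝ)) ^ (d - 1)) * Real.exp (-(c * ((j + 1 : ℕ) : ℝ))) := by
          gcongr
      _ = 2 * d * 3 ^ (d - 1) * ((((j + 1 : ℕ) : ℝ)) ^ (d - 1)
            * Real.exp (-(c / 2 * ((j + 1 : ℕ) : ℝ)))) * (x ^ j * x) := by
          rw [hsplit, mul_pow]; ring
      _ ≤ 2 * d * 3 ^ (d - 1) * K * (x ^ j * 1) := by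
          have hp' :
              (((j + 1 : ℕ) : ℝ)) ^ (d - 1) * Real.exp (-(c / 2 * ((j + 1 : ℕ) : ℝ))) ≤ K := by
            rw [hK]; exact hp
          have hxj : x ^ j * x ≤ x ^ j * 1 := mul_le_mul_of_nonneg_left hx1.le (pow_nonneg hx0 j)
          exact mul_le_mul
            (mul_le_mul_of_nonneg_left hp' (by positivity : (0 : ℝ) ≤ 2 * (d : ℝ) * 3 ^ (d - 1)))
            hxj (mul_nonneg (pow_nonneg hx0 j) hx0)
            (mul_nonneg (by positivity : (0 : ℝ) ≤ 2 * (d : ℝ) * 3 ^ (d - 1)) hK0)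
      _ = 2 * d * 3 ^ (d - 1) * K * x ^ j := by ring
  have hgeom : ∑ j ∈ Finset.range R, x ^ j ≤ (1 - x)⁻¹ := by
    have h := geom_sum_Ico_le_of_lt_one (m := 0) (n := R) hx0 hx1
    rw [pow_zero, ← Finset.range_eq_Ico, one_div] at h
    exact h
  calc (∑ j ∈ Finset.range R, (((cube (0 : Fin d → ℤ) R).filter
            (fun z => supNorm z = (j + 1))).card : ℝ) * Real.exp (-(c * ((j + 1 : ℕ) : ℝ)))) + 1
      ≤ (∑ j ∈ Finset.range R, 2 * d * 3 ^ (d - 1) * K * x ^ j) + 1 :=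
        add_le_add (Finset.sum_le_sum fun j _ => hterm j) le_rfl
    _ = 2 * d * 3 ^ (d - 1) * K * ∑ j ∈ Finset.range R, x ^ j + 1 := by rw [Finset.mul_sum]
    _ ≤ 2 * d * 3 ^ (d - 1) * K * (1 - x)⁻¹ + 1 :=
        add_le_add (mul_le_mul_of_nonneg_left hgeom
          (mul_nonneg (by positivity : (0 : ℝ) ≤ 2 * (d : ℝ) * 3 ^ (d - 1)) hK0)) le_rfl
    _ = _ := by ring

end Conversions

/-! ## §6 Block geometry of the fine torus against the centred lift (R-g31-1 (b), (c)) -/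

section Geometry

open Literature.MathematicalPhysics.QuantumFieldTheory.Balaban1983to89.Beta.PoissonInterior

variable {d : ℕ}

/-- the sup-distance of the torus `Π_μ ℤ/N_μ` read through the centred lift,
`tdist y y′ = ‖liftZ (y′ − y)‖_∞` (circular sup-distance; `≤` the Euclidean one of (1.110)).
[folklore] -/
def tdist {N : Fin d → ℕ} (y y' : (μ : Fin d) → ZMod (N μ)) : ℕ := supNorm (liftZ (y' - y))

/-- Elementary helper of §6 (`tdist_self`); the statement is its own description. [folklore] -/
theorem tdist_self {N : Fin d → ℕ} (y : (μ : Fin d) → ZMod (N μ)) : tdist y y = 0 := by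
  rw [tdist, sub_self, liftZ_zero, supNorm_zero]

variable {N : Fin d → ℕ} [hN : ∀ μ, NeZero (N μ)]

/-- MINIMALITY OF THE CENTRED LIFT, coordinatewise: every integer representative is at least as
large in absolute value. [folklore] -/
theorem natAbs_liftZ_le_of_castT_eq {z : (μ : Fin d) → ZMod (N μ)} {w : Fin d → ℤ}
    (hw : castT N w = z) (μ : Fin d) : (liftZ z μ).natAbs ≤ (w μ).natAbs :=
  ZMod.natAbs_min_of_le_div_two (N μ) (liftZ z μ) (w μ)
    (by rw [liftZ, ZMod.coe_valMinAbs]; exact (congrFun hw μ).symm) (ZMod.natAbs_valMinAbs_le _)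

/-- minimality in the sup norm: `‖liftZ z‖_∞ ≤ ‖w‖_∞` for every representative `w` of `z`.
[folklore] -/
theorem supNorm_liftZ_le_of_castT_eq {z : (μ : Fin d) → ZMod (N μ)} {w : Fin d → ℤ}
    (hw : castT N w = z) : supNorm (liftZ z) ≤ supNorm w :=
  supNorm_le_iff.mpr fun μ => (natAbs_liftZ_le_of_castT_eq hw μ).trans (natAbs_le_supNorm w μ)

omit hN in
/-- the triangle inequality of `tdist`. [folklore] -/
theorem tdist_triangle [∀ μ, NeZero (N μ)] (a b c : (μ : Fin d) → ZMod (N μ)) :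
    tdist a c ≤ tdist a b + tdist b c := by
  have hw : castT N (liftZ (b - a) + liftZ (c - b)) = c - a := by
    rw [castT_add, castT_liftZ, castT_liftZ]; abel
  calc tdist a c = supNorm (liftZ (c - a)) := rfl
    _ ≤ supNorm (liftZ (b - a) + liftZ (c - b)) := supNorm_liftZ_le_of_castT_eq hw
    _ ≤ supNorm (liftZ (b - a)) + supNorm (liftZ (c - b)) := supNorm_add_le _ _

omit hN in
/-- `tdist` is symmetric (`|valMinAbs(−z)| = |valMinAbs z|`). [folklore] -/
theorem tdist_comm [∀ μ, NeZero (N μ)] (y y' : (μ : Fin d) → ZMod (N μ)) :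
    tdist y y' = tdist y' y := by
  unfold tdist supNorm
  congr 1
  funext μ
  simp only [liftZ, Pi.sub_apply]
  rw [← neg_sub (y μ) (y' μ), ZMod.natAbs_valMinAbs_neg]

omit hN in
/-- **VOLUME-UNIFORM SUMMABILITY ON THE TORUS** (R-g31-1 (c), the `hS` input of
`VectorTails.norm_entry_le_of_parametrix`): for `d ≥ 2` and `c > 0` there is `S = S(c, d)` with
`Σ_{y′ ∈ Π_μ ℤ/N_μ} e^{−c·tdist(y, y′)} ≤ S` for EVERY volume `N` and every `y` (lift injectively
into the centred box of `ℤ^d` and use `sum_cube_exp_supNorm_le`). [folklore] -/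
theorem sum_exp_tdist_le (hd : 2 ≤ d) {c : ℝ} (hc : 0 < c) :
    ∃ S : ℝ, 0 ≤ S ∧ ∀ (N : Fin d → ℕ) [∀ μ, NeZero (N μ)] (y : (μ : Fin d) → ZMod (N μ)),
      ∑ y', Real.exp (-(c * (tdist y y' : ℝ))) ≤ S := by
  set S : ℝ := 1 + 2 * d * 3 ^ (d - 1) * ((((d - 1 : ℕ) : ℝ)) / (c / 2)) ^ (d - 1)
      * (1 - Real.exp (-(c / 2)))⁻¹ with hS
  have hS0 : 0 ≤ S :=
    (Finset.sum_nonneg fun z _ => (Real.exp_pos _).le).trans (sum_cube_exp_supNorm_le hd hc 0)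
  refine ⟨S, hS0, fun N _ y => ?_⟩
  -- recenter: y' = y + z
  have e1 : ∑ y', Real.exp (-(c * (tdist y y' : ℝ)))
      = ∑ z : (μ : Fin d) → ZMod (N μ), Real.exp (-(c * (supNorm (liftZ z) : ℝ))) := by
    refine (Fintype.sum_equiv (Equiv.addLeft y) _ _ fun z => ?_).symm
    simp [tdist]
  rw [e1]
  -- lift injectively into the centred box `cube 0 R`, `R = max_μ N_μ / 2`
  set R : ℕ := Finset.univ.sup fun μ : Fin d => N μ / 2 with hR
  have himg : ∀ z : (μ : Fin d) → ZMod (N μ), liftZ z ∈ cube (0 : Fin d → ℤ) R := by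
    intro z
    rw [mem_cube_zero_iff, supNorm_le_iff]
    intro μ
    exact (natAbs_liftZ_le z μ).trans (Finset.le_sup (f := fun μ : Fin d => N μ / 2)
      (Finset.mem_univ μ))
  have e2 : ∑ z : (μ : Fin d) → ZMod (N μ), Real.exp (-(c * (supNorm (liftZ z) : ℝ)))
      = ∑ w ∈ Finset.univ.image (liftZ (N := N)), Real.exp (-(c * (supNorm w : ℝ))) := by
    rw [Finset.sum_image fun z₁ _ z₂ _ h => liftZ_injective h]
  rw [e2]
  calc ∑ w ∈ Finset.univ.image (liftZ (N := N)), Real.exp (-(c * (supNorm w : ℝ)))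
      ≤ ∑ w ∈ cube (0 : Fin d → ℤ) R, Real.exp (-(c * (supNorm w : ℝ))) := by
        refine Finset.sum_le_sum_of_subset_of_nonneg ?_ fun w _ _ => (Real.exp_pos _).le
        intro w hw
        obtain ⟨z, _, rfl⟩ := Finset.mem_image.mp hw
        exact himg z
    _ ≤ S := sum_cube_exp_supNorm_le hd hc R

/-- PACKAGING A BOUNDED SOURCE OF BOUNDED BLOCK RANGE into the exponential block envelope asked by
`VectorTails.norm_entry_le_of_parametrix` (`hρ`, `hVh`): if `‖J‖ ≤ B` pointwise and `J` vanishes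
off the blocks at distance `≤ ℓ` from `y₀`, then `‖J|_{y′}‖ ≤ B e^{δ′ℓ} · e^{−δ′ d(y′, y₀)}`.
[folklore] -/
theorem norm_restrictBlk_le_envelope {X Y : Type*} [Fintype X] [DecidableEq Y] {J : X → ℂ}
    {blk : X → Y} {dist : Y → Y → ℝ} {y₀ : Y} {B ℓ δ' : ℝ} (hB : 0 ≤ B) (hδ' : 0 ≤ δ')
    (hJ : ∀ z, ‖J z‖ ≤ B) (hsupp : ∀ z, J z ≠ 0 → dist (blk z) y₀ ≤ ℓ) (y' : Y) :
    ‖restrictBlk blk J y'‖ ≤ B * Real.exp (δ' * ℓ) * Real.exp (-(δ' * dist y' y₀)) := by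
  by_cases h : ∃ z, blk z = y' ∧ J z ≠ 0
  · obtain ⟨z, hz, hJz⟩ := h
    have hd : dist y' y₀ ≤ ℓ := hz ▸ hsupp z hJz
    have h1 : ‖restrictBlk blk J y'‖ ≤ B := by
      refine (pi_norm_le_iff_of_nonneg hB).mpr fun z' => ?_
      by_cases hz' : blk z' = y'
      · simp only [restrictBlk, hz', if_true]; exact hJ z'
      · rw [restrictBlk_apply_of_ne blk J hz', norm_zero]; exact hB
    have h2 : (1 : ℝ) ≤ Real.exp (δ' * ℓ) * Real.exp (-(δ' * dist y' y₀)) := by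
      rw [← Real.exp_add]
      exact Real.one_le_exp (by nlinarith)
    calc ‖restrictBlk blk J y'‖ ≤ B * 1 := by rw [mul_one]; exact h1
      _ ≤ B * (Real.exp (δ' * ℓ) * Real.exp (-(δ' * dist y' y₀))) :=
          mul_le_mul_of_nonneg_left h2 hB
      _ = _ := by ring
  · push Not at h
    have h0 : restrictBlk blk J y' = 0 := by
      funext z'
      by_cases hz' : blk z' = y'
      · simp only [restrictBlk, hz', if_true, Pi.zero_apply]; exact h z' hz'
      · exact restrictBlk_apply_of_ne blk J hz'
    rw [h0, norm_zero]
    positivity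

end Geometry

section Blocks

open Literature.MathematicalPhysics.QuantumFieldTheory.Balaban1983to89.Beta.PoissonInterior
open Literature.MathematicalPhysics.QuantumFieldTheory.Balaban1983to89.B5Blocks16

variable {d : ℕ} (n : ℕ) [NeZero n] (M : Fin d → ℕ) [hM : ∀ μ, NeZero (M μ)]

/-- THE DIGIT CONGRUENCE: the centred lift of `x − x₀` for block points `x = n·y + j`,
`x₀ = n·y₀ + j₀` is `n·liftZ(y − y₀) + (j − j₀)` up to a period `nM_ν`. [folklore] -/
theorem liftZ_bpt_sub_bpt (y y₀ : Tor M) (j j₀ : Fin d → Fin n) (ν : Fin d) :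
    ∃ t : ℤ, (liftZ (bpt n M y j - bpt n M y₀ j₀) ν : ℤ)
      = n * liftZ (y - y₀) ν + (((j ν : ℕ) : ℤ) - ((j₀ ν : ℕ) : ℤ)) + (fine n M ν : ℤ) * t := by
  -- the block digits as integers
  have hx : ∀ (y' : Tor M) (j' : Fin d → Fin n),
      (bpt n M y' j' ν : ZMod (fine n M ν))
        = (((n * (y' ν).val + (j' ν : ℕ) : ℕ) : ℤ) : ZMod _) := by
    intro y' j'
    rw [Int.cast_natCast, ← bpt_val n M y' j' ν, ZMod.natCast_zmod_val]
  -- `liftZ (y − y₀) ν ≡ val y − val y₀ (mod M_ν)`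
  have hL : ((((y ν).val : ℤ) - ((y₀ ν).val : ℤ) : ℤ) : ZMod (M ν))
      = ((liftZ (y - y₀) ν : ℤ) : ZMod (M ν)) := by
    rw [liftZ, ZMod.coe_valMinAbs, Int.cast_sub, Int.cast_natCast, Int.cast_natCast,
      ZMod.natCast_zmod_val, ZMod.natCast_zmod_val, Pi.sub_apply]
  obtain ⟨s, hs⟩ := (ZMod.intCast_eq_intCast_iff_dvd_sub _ _ _).mp hL
  -- `liftZ (x − x₀) ν ≡ (n val y + j) − (n val y₀ + j₀) (mod nM_ν)`
  have hV : ((((n * (y ν).val + (j ν : ℕ) : ℕ) : ℤ) - ((n * (y₀ ν).val + (j₀ ν : ℕ) : ℕ) : ℤ) : ℤ)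
        : ZMod (fine n M ν))
        = ((liftZ (bpt n M y j - bpt n M y₀ j₀) ν : ℤ) : ZMod (fine n M ν)) := by
    rw [liftZ, ZMod.coe_valMinAbs, Pi.sub_apply, Int.cast_sub, ← hx, ← hx]
  obtain ⟨t, ht⟩ := (ZMod.intCast_eq_intCast_iff_dvd_sub _ _ _).mp hV
  refine ⟨t - s, ?_⟩
  have hfine : ((fine n M ν : ℕ) : ℤ) = (n : ℤ) * (M ν : ℤ) := by
    rw [show fine n M ν = n * M ν from rfl, Nat.cast_mul]
  rw [hfine] at ht ⊢
  have ht' := ht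
  push_cast at ht' hs ⊢
  linear_combination ht' - (n : ℤ) * hs

/-- **FINE DISTANCE VERSUS BLOCK DISTANCE, coordinatewise**: with `v = liftZ (x − x₀)` and
`y = blockOf x`, `y₀ = blockOf x₀`: `|v_ν| ≤ n·|liftZ(y − y₀)_ν| + (n − 1)` and
`n·|liftZ(y − y₀)_ν| ≤ |v_ν| + (n − 1)`. [folklore] -/
theorem natAbs_liftZ_sub_le (x x₀ : Tor (fine n M)) (ν : Fin d) :
    (liftZ (x - x₀) ν).natAbs
      ≤ n * (liftZ (B5Blocks16.blockOf n M x - B5Blocks16.blockOf n M x₀) ν).natAbs + (n - 1)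
    ∧ n * (liftZ (B5Blocks16.blockOf n M x - B5Blocks16.blockOf n M x₀) ν).natAbs
      ≤ (liftZ (x - x₀) ν).natAbs + (n - 1) := by
  obtain ⟨⟨y, j⟩, rfl⟩ := (bpt_bijective n M).2 x
  obtain ⟨⟨y₀, j₀⟩, rfl⟩ := (bpt_bijective n M).2 x₀
  simp only [B5Blocks16.blockOf_bpt]
  obtain ⟨t, ht⟩ := liftZ_bpt_sub_bpt n M y y₀ j j₀ ν
  set v : ℤ := liftZ (bpt n M y j - bpt n M y₀ j₀) ν with hv
  set L : ℤ := liftZ (y - y₀) ν with hL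
  have hn0 : 0 < n := Nat.pos_of_ne_zero (NeZero.ne n)
  have hj : ((j ν : ℕ) : ℤ) < n := by exact_mod_cast (j ν).is_lt
  have hj₀ : ((j₀ ν : ℕ) : ℤ) < n := by exact_mod_cast (j₀ ν).is_lt
  have hj0 : (0 : ℤ) ≤ ((j ν : ℕ) : ℤ) := by positivity
  have hj₀0 : (0 : ℤ) ≤ ((j₀ ν : ℕ) : ℤ) := by positivity
  have hfine' : ∀ μ, ((fine n M μ : ℕ) : ℤ) = ((n * M μ : ℕ) : ℤ) := fun μ => rfl
  have hfine : ((fine n M ν : ℕ) : ℤ) = (n : ℤ) * (M ν : ℤ) := by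
    rw [show fine n M ν = n * M ν from rfl, Nat.cast_mul]
  rw [hfine] at ht
  constructor
  · -- minimality of `v` against the representative `nL + (j − j₀)`
    have hrep : castT (fine n M) (fun μ => (n : ℤ) * liftZ (y - y₀) μ
        + (((j μ : ℕ) : ℤ) - ((j₀ μ : ℕ) : ℤ))) = bpt n M y j - bpt n M y₀ j₀ := by
      funext μ
      obtain ⟨t', ht'⟩ := liftZ_bpt_sub_bpt n M y y₀ j j₀ μ
      rw [hfine'] at ht'
      have e : (n : ℤ) * liftZ (y - y₀) μ + (((j μ : ℕ) : ℤ) - ((j₀ μ : ℕ) : ℤ))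
          = liftZ (bpt n M y j - bpt n M y₀ j₀) μ + ((n * M μ : ℕ) : ℤ) * (-t') := by
        rw [ht']; push_cast; ring
      show (((n : ℤ) * liftZ (y - y₀) μ + (((j μ : ℕ) : ℤ) - ((j₀ μ : ℕ) : ℤ)) : ℤ)
          : ZMod (fine n M μ)) = (bpt n M y j - bpt n M y₀ j₀) μ
      have hz : ((n * M μ : ℕ) : ZMod (fine n M μ)) = 0 := ZMod.natCast_self (n * M μ)
      rw [e, Int.cast_add, Int.cast_mul, Int.cast_natCast, hz, zero_mul, add_zero]
      exact ZMod.coe_valMinAbs _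
    have hmin : v.natAbs ≤ ((n : ℤ) * L + (((j ν : ℕ) : ℤ) - ((j₀ ν : ℕ) : ℤ))).natAbs :=
      natAbs_liftZ_le_of_castT_eq hrep ν
    have htri : ((n : ℤ) * L + (((j ν : ℕ) : ℤ) - ((j₀ ν : ℕ) : ℤ))).natAbs
        ≤ n * L.natAbs + (n - 1) := by
      have h1 := Int.natAbs_add_le ((n : ℤ) * L) (((j ν : ℕ) : ℤ) - ((j₀ ν : ℕ) : ℤ))
      rw [Int.natAbs_mul, Int.natAbs_natCast] at h1
      have h2 : (((j ν : ℕ) : ℤ) - ((j₀ ν : ℕ) : ℤ)).natAbs ≤ n - 1 := by omega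
      omega
    exact hmin.trans htri
  · -- minimality of `L` against the representative `(v − (j − j₀))/n = L + M t`-shifted
    -- from `v = nL + (j − j₀) + nM t`: `n (L + M t) = v − (j − j₀)`
    have hrep : castT M (fun μ => liftZ (y - y₀) μ) = y - y₀ := castT_liftZ _
    -- representative `L + M t` of `(y − y₀) ν`; compare `L` with it via minimality
    have hmin : L.natAbs ≤ (L + (M ν : ℤ) * t).natAbs := by
      refine ZMod.natAbs_min_of_le_div_two (M ν) L (L + (M ν : ℤ) * t) ?_ ?_
      · push_cast
        rw [ZMod.natCast_self, zero_mul, add_zero]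
      · exact ZMod.natAbs_valMinAbs_le _
    have hnL : (n : ℤ) * (L + (M ν : ℤ) * t) = v - (((j ν : ℕ) : ℤ) - ((j₀ ν : ℕ) : ℤ)) := by
      rw [ht]; ring
    have h1 : n * (L + (M ν : ℤ) * t).natAbs
        = (v - (((j ν : ℕ) : ℤ) - ((j₀ ν : ℕ) : ℤ))).natAbs := by
      rw [← hnL, Int.natAbs_mul, Int.natAbs_natCast]
    have h2 : (v - (((j ν : ℕ) : ℤ) - ((j₀ ν : ℕ) : ℤ))).natAbs ≤ v.natAbs + (n - 1) := by
      have := Int.natAbs_sub_le v (((j ν : ℕ) : ℤ) - ((j₀ ν : ℕ) : ℤ))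
      have h3 : (((j ν : ℕ) : ℤ) - ((j₀ ν : ℕ) : ℤ)).natAbs ≤ n - 1 := by omega
      omega
    calc n * L.natAbs ≤ n * (L + (M ν : ℤ) * t).natAbs := Nat.mul_le_mul_left n hmin
      _ = _ := h1
      _ ≤ v.natAbs + (n - 1) := h2

/-- **FINE DISTANCE VERSUS BLOCK DISTANCE** in the sup norm: `|v|_∞ ≤ n·tdist + (n − 1)` and
`n·tdist ≤ |v|_∞ + (n − 1)` for `v = liftZ (x − x₀)` and the block distance
`tdist (blockOf x₀) (blockOf x)` — whence `e^{−δ₀·tdist} ≤ e^{δ₀} e^{−(δ₀/n)|v|_∞}` and a source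
supported in `|v|_∞ ≤ 3m` lives in blocks at distance `≤ 3m/n + 1`. [folklore] -/
theorem supNorm_liftZ_sub_le (x x₀ : Tor (fine n M)) :
    supNorm (liftZ (x - x₀))
        ≤ n * tdist (B5Blocks16.blockOf n M x₀) (B5Blocks16.blockOf n M x) + (n - 1)
    ∧ n * tdist (B5Blocks16.blockOf n M x₀) (B5Blocks16.blockOf n M x)
        ≤ supNorm (liftZ (x - x₀)) + (n - 1) := by
  constructor
  · refine supNorm_le_iff.mpr fun ν => (natAbs_liftZ_sub_le n M x x₀ ν).1.trans ?_
    exact Nat.add_le_add_right (Nat.mul_le_mul_left n (natAbs_le_supNorm _ ν)) _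
  · -- pick the coordinate realising the block sup norm
    rw [tdist]
    by_cases hd : 0 < d
    · obtain ⟨ν, hν⟩ := exists_natAbs_eq_supNorm hd
        (liftZ (B5Blocks16.blockOf n M x - B5Blocks16.blockOf n M x₀))
      rw [← hν]
      exact (natAbs_liftZ_sub_le n M x x₀ ν).2.trans
        (Nat.add_le_add_right (natAbs_le_supNorm _ ν) _)
    · have hd0 : d = 0 := by omega
      subst hd0
      simp [supNorm]

/-- one unit-lattice step has `tdist ≤ 1`. [folklore] -/
theorem tdist_add_unitVec_le (y : Tor M) (μ : Fin d) : tdist y (y + unitVec M μ) ≤ 1 := by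
  rw [tdist, add_sub_cancel_left]
  have hw : castT M (Pi.single μ (1 : ℤ)) = unitVec M μ := castT_single M μ
  exact (supNorm_liftZ_le_of_castT_eq hw).trans (supNorm_single_one μ)

omit [NeZero n] hM in
/-- A STAPLE STAYS WITHIN ONE BLOCK STEP: `n·y + j + t e_μ`, `0 ≤ t < n`, is a block point of
`y` or of `y + e_μ`. [folklore] -/
theorem bpt_add_tstep (y : Tor M) (j : Fin d → Fin n) (μ : Fin d) (t : ℕ) (ht : t < n) :
    ∃ (y' : Tor M) (j' : Fin d → Fin n), bpt n M y j + tstep (fine n M) μ t = bpt n M y' j'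
      ∧ (y' = y ∨ y' = y + unitVec M μ) := by
  by_cases hs : (j μ : ℕ) + t < n
  · refine ⟨y, Function.update j μ ⟨(j μ : ℕ) + t, hs⟩, ?_, Or.inl rfl⟩
    show up n M y + iota n M j + tstep (fine n M) μ t = up n M y + iota n M _
    rw [add_assoc]
    congr 1
    funext ν
    simp only [iota, tstep, Pi.add_apply, Function.update_apply]
    by_cases hν : ν = μ
    · subst hν; simp
    · simp [hν]
  · have hs' : (j μ : ℕ) + t - n < n := by omega
    refine ⟨y + unitVec M μ, Function.update j μ ⟨(j μ : ℕ) + t - n, hs'⟩, ?_, Or.inr rfl⟩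
    show up n M y + iota n M j + tstep (fine n M) μ t = up n M (y + unitVec M μ) + iota n M _
    rw [up_add, up_unitVec, add_assoc, add_assoc]
    congr 1
    funext ν
    simp only [iota, tstep, Pi.add_apply, Function.update_apply]
    by_cases hν : ν = μ
    · subst hν
      simp only [if_true]
      have e : (j ν : ℕ) + t = n + ((j ν : ℕ) + t - n) := by omega
      rw [← Nat.cast_add, ← Nat.cast_add, ← e]
    · simp [hν]

/-- **THE SUPPORT OF `Q_k` IN BLOCK TERMS**: an entry `Q_k((y, μ), (x, κ)) ≠ 0` forces `x` into
the block of `y` or of `y + e_μ`, so `tdist y (blk x) ≤ 1` (the staples of (1.18) have length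
`n` fine steps). [folklore] -/
theorem tdist_blockOf_le_one_of_QvOp_ne_zero (y : Tor M) (μ : Fin d) (x : Tor (fine n M))
    (κ : Fin d) (h : QvOp n M (y, μ) (x, κ) ≠ 0) :
    tdist y (B5Blocks16.blockOf n M x) ≤ 1 := by
  simp only [QvOp] at h
  by_cases hκ : κ = μ
  · rw [if_pos hκ] at h
    obtain ⟨j, -, hj⟩ := Finset.exists_ne_zero_of_sum_ne_zero h
    obtain ⟨t, -, hjt⟩ := Finset.exists_ne_zero_of_sum_ne_zero hj
    have hx : x = bpt n M y j + tstep (fine n M) μ t := by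
      by_contra hne; exact hjt (if_neg hne)
    obtain ⟨y', j', he, hy'⟩ := bpt_add_tstep n M y j μ t t.is_lt
    rw [hx, he, B5Blocks16.blockOf_bpt]
    rcases hy' with rfl | rfl
    · rw [tdist_self]; exact zero_le_one
    · exact tdist_add_unitVec_le M _ μ
  · exact absurd (if_neg hκ) h

end Blocks

end

end Literature.MathematicalPhysics.QuantumFieldTheory.Balaban1983to89.Beta.VectorTailsCov
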